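import Literature.Geometry.Riemannian.PoincareCompositePiece
import Literature.Geometry.Lorentzian.VolumePositivity
import HarnessLib

/-!
# The Poincaré–Wirtinger inequality on a connected regular sublevel domain

Topic `Geometry/Riemannian`. Theorem file (no definitions, no named facts; everything proved).
Let `h` be a smooth Riemannian metric on a manifold `M` modelled on `ℝᵐ` and `D = {σ < 0}` a
connected regular sublevel domain with compact closure (`σ ∈ C^∞(M)`, `{σ ≤ 0}` compact,
`dσ ≠ 0` on `{σ = 0}`). Then there is `C < ∞` with

  `‖f − ⨍_D f dμ_h‖_{L²(D, μ_h)} ≤ C (∫_D h⁻¹(df, df) dμ_h)^{1/2}`   for every `f ∈ C¹(M)`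

(`exists_poincareWirtinger_sublevel`; V. G. Maz'ja, *Sobolev Spaces* (1985), §1.1.11; E. Hebey,
*Nonlinear Analysis on Manifolds* (1999), §2.2; L. C. Evans, *PDE* (2010), §5.8.1 Thm. 1).
Proof: every point of `D̄` has a neighbourhood `V` such that `V ∩ D` is a convex composite chart
piece — an interior coordinate ball, or, at a boundary point, the half-ball of a
boundary-flattening chart (`exists_boundaryFlatteningChart`, `sublevel_inter_compositePiece`) — on
which the local inequality `exists_poincare_compositePiece` holds; finitely many such `V` cover
`D̄`, and the local inequalities are glued along the connected `D` by
`exists_eLpNorm_sub_setAverage_le_of_finite_cover`.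

## References

* V. G. Maz'ja, *Sobolev Spaces* (1985), §1.1.11. [Mazja1985]
* E. Hebey, *Nonlinear Analysis on Manifolds: Sobolev Spaces and Inequalities* (1999), §2.2.
* L. C. Evans, *Partial Differential Equations*, 2nd ed. (2010), §5.8.1. [Evans2010]
-/

noncomputable section

open MeasureTheory Measure Set Filter Metric Module InnerProductSpace TopologicalSpace
open scoped ENNReal NNReal Manifold ContDiff Topology RealInnerProductSpace

namespace Literature.Geometry.Riemannian

open Lorentzian
open Bundle PseudoRiemannianMetric Literature.Analysis.FunctionSpaces Literature.Geometry.Manifold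
  Literature.Analysis.PDE

variable {m : ℕ} {M : Type*} [TopologicalSpace M] [ChartedSpace (EuclideanSpace ℝ (Fin m)) M]
  [IsManifold (𝓡 m) ∞ M] [T2Space M] [LocallyCompactSpace M] [MeasurableSpace M] [BorelSpace M]

variable (h : ContMDiffRiemannianMetric (𝓡 m) ∞ (EuclideanSpace ℝ (Fin m))
  (TangentSpace (𝓡 m) : M → Type _))

/-- A nonzero `ν` gives a point of the half-ball `B(z, R) ∩ {⟪w - z, ν⟫ < 0}`. [folklore] -/
private theorem halfBall_nonempty' {ν z : EuclideanSpace ℝ (Fin m)} (hν : ν ≠ 0) {R : ℝ}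
    (hR : 0 < R) : (ball z R ∩ {w | ⟪w - z, ν⟫ < 0}).Nonempty := by
  have hn : 0 < ‖ν‖ := norm_pos_iff.2 hν
  set t : ℝ := R / 2 / ‖ν‖ with ht
  have ht0 : 0 < t := by positivity
  refine ⟨z - t • ν, ?_, ?_⟩
  · rw [mem_ball, dist_eq_norm, sub_sub_cancel_left, norm_neg, norm_smul, Real.norm_eq_abs,
      abs_of_pos ht0, ht, div_mul_cancel₀ _ hn.ne']
    linarith
  · show ⟪z - t • ν - z, ν⟫ < 0
    rw [sub_sub_cancel_left, inner_neg_left, inner_smul_left, real_inner_self_eq_norm_sq]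
    simp only [RCLike.conj_to_real, neg_neg_iff_pos]
    positivity

/-- **Local Poincaré–Wirtinger near every point of `D̄`**: for `σ` smooth with `dσ ≠ 0` on
`{σ = 0}` and `x` with `σ x ≤ 0`, there are an open `V ∋ x` and `C < ∞` with
`‖f − ⨍_{V ∩ D} f‖_{L²(V ∩ D)} ≤ C (∫_{V ∩ D} h⁻¹(df, df))^{1/2}` for all `f ∈ C¹(M)`,
`D = {σ < 0}` (interior coordinate balls, boundary half-balls). [folklore] -/
theorem exists_local_poincare_sublevel {σ : M → ℝ} (hσ : ContMDiff (𝓡 m) 𝓘(ℝ, ℝ) ∞ σ)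
    (hreg : ∀ x, σ x = 0 → mvfderiv (𝓡 m) σ x ≠ 0) {x : M} (hx : σ x ≤ 0) :
    ∃ V : Set M, IsOpen V ∧ x ∈ V ∧ ∃ C : ℝ≥0∞, C ≠ ⊤ ∧ ∀ f : M → ℝ,
      ContMDiff (𝓡 m) 𝓘(ℝ, ℝ) 1 f →
      eLpNorm (fun p ↦ f p - ⨍ q in V ∩ {p | σ p < 0}, f q ∂riemannianMeasure h) 2
        ((riemannianMeasure h).restrict (V ∩ {p | σ p < 0})) ≤
      C * (∫⁻ p in V ∩ {p | σ p < 0},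
        ENNReal.ofReal ((PseudoRiemannianMetric.ofRiemannian h).innerDual p
          (mvfderiv (𝓡 m) f p).toLinearMap (mvfderiv (𝓡 m) f p).toLinearMap)
            ∂riemannianMeasure h) ^ (1 / 2 : ℝ) := by
  set φ := extChartAt (𝓡 m) x with hφ
  set D : Set M := {p | σ p < 0} with hD
  rcases hx.lt_or_eq with hlt | heq
  · -- interior point: a coordinate ball inside `D`
    have hTo : IsOpen φ.target := isOpen_extChartAt_target x
    set O : Set (EuclideanSpace ℝ (Fin m)) := φ.target ∩ (σ ∘ φ.symm) ⁻¹' Iio 0 with hO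
    have hOo : IsOpen O :=
      (hσ.continuous.comp_continuousOn (continuousOn_extChartAt_symm x)).isOpen_inter_preimage
        hTo isOpen_Iio
    have hxO : φ x ∈ O := by
      refine ⟨φ.map_source (mem_extChartAt_source x), ?_⟩
      show σ (φ.symm (φ x)) < 0
      rw [φ.left_inv (mem_extChartAt_source x)]; exact hlt
    obtain ⟨r, hr, hball⟩ := Metric.nhds_basis_closedBall.mem_iff.1 (hOo.mem_nhds hxO)
    set Ψ := OpenPartialHomeomorph.ofSet φ.target hTo with hΨ
    have hΨt : Ψ.source ⊆ φ.target := by rw [hΨ, OpenPartialHomeomorph.ofSet_source]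
    have hΨs : ContDiffOn ℝ ∞ Ψ Ψ.source := by
      rw [hΨ, OpenPartialHomeomorph.ofSet_apply]; exact contDiffOn_id
    have hΨs' : ContDiffOn ℝ ∞ Ψ.symm Ψ.target := by
      rw [hΨ, OpenPartialHomeomorph.ofSet_symm, OpenPartialHomeomorph.ofSet_apply]
      exact contDiffOn_id
    have himg : ∀ B : Set (EuclideanSpace ℝ (Fin m)), Ψ.symm '' B = B := fun B => by
      rw [hΨ, OpenPartialHomeomorph.ofSet_symm, OpenPartialHomeomorph.ofSet_apply, image_id]
    have hcl : closure (ball (φ x) r) ⊆ Ψ.target := by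
      rw [hΨ, OpenPartialHomeomorph.ofSet_target, closure_ball _ hr.ne']
      exact hball.trans inter_subset_left
    obtain ⟨C, hC, hPW⟩ := exists_poincare_compositePiece h x hΨt hΨs hΨs' isOpen_ball
      (convex_ball _ _) ⟨φ x, mem_ball_self hr⟩
      (by rw [closure_ball _ hr.ne']; exact isCompact_closedBall _ _) hcl
    set V : Set M := φ.source ∩ φ ⁻¹' (ball (φ x) r) with hV
    have hVD : V ⊆ D := by
      rintro p ⟨hp, hpb⟩
      have h1 := (hball (ball_subset_closedBall hpb)).2
      simp only [mem_preimage, Function.comp_apply, φ.left_inv hp, mem_Iio] at h1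
      exact h1
    have hVe : V ∩ D = φ.source ∩ φ ⁻¹' (Ψ.symm '' ball (φ x) r) := by
      rw [inter_eq_left.2 hVD, himg]
    refine ⟨V, isOpen_extChartAt_preimage' x isOpen_ball, ⟨mem_extChartAt_source x, mem_ball_self hr⟩,
      C, hC, fun f hf => ?_⟩
    rw [hVe]
    exact hPW f hf
  · -- boundary point: a half-ball of a boundary-flattening chart
    have hreg' : mfderiv (𝓡 m) 𝓘(ℝ, ℝ) σ x ≠ 0 := fun h0 => hreg x heq (by simp [mvfderiv, h0])
    obtain ⟨Ψ, ν, R, hν, hR, hΨV, hzΨ, hΨz, hΨs, hΨs', hball, hlin⟩ :=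
      exists_boundaryFlatteningChart hσ heq hreg'
    have hR2 : 0 < R / 2 := by positivity
    have hbt : ball (φ x) (R / 2) ⊆ Ψ.target :=
      (ball_subset_closedBall.trans (closedBall_subset_closedBall (by linarith))).trans hball
    set Q : Set (EuclideanSpace ℝ (Fin m)) := ball (φ x) (R / 2) ∩ {w | ⟪w - φ x, ν⟫ < 0} with hQ
    have hQe : Q = (halfBall ν (φ x) (R / 2) : Set (EuclideanSpace ℝ (Fin m))) := by
      rw [hQ, halfBall_coe]; rfl
    have hQo : IsOpen Q := by rw [hQe]; exact (halfBall ν (φ x) (R / 2)).isOpen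
    have hQc : Convex ℝ Q := by rw [hQe]; exact convex_halfBall
    have hQne : Q.Nonempty := halfBall_nonempty' hν hR2
    have hclQ : closure Q ⊆ closedBall (φ x) (R / 2) :=
      (closure_mono inter_subset_left).trans (by rw [closure_ball _ hR2.ne'])
    have hKc : IsCompact (closure Q) := (isCompact_closedBall _ _).of_isClosed_subset isClosed_closure hclQ
    have hKt : closure Q ⊆ Ψ.target :=
      hclQ.trans ((closedBall_subset_closedBall (by linarith)).trans hball)
    obtain ⟨C, hC, hPW⟩ := exists_poincare_compositePiece h x hΨV hΨs hΨs' hQo hQc hQne hKc hKt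
    set V : Set M := φ.source ∩ φ ⁻¹' (Ψ.symm '' ball (φ x) (R / 2)) with hV
    have hVe : V ∩ D = φ.source ∩ φ ⁻¹' (Ψ.symm '' Q) := by
      rw [inter_comm, hD, sublevel_inter_compositePiece hlin hbt]
    refine ⟨V, isOpen_compositePiece isOpen_ball hbt, mem_compositePiece hzΨ hΨz (mem_ball_self hR2),
      C, hC, fun f hf => ?_⟩
    rw [hVe]
    exact hPW f hf

/-- **Poincaré–Wirtinger inequality on a connected regular sublevel domain.** Let `h` be a smooth
Riemannian metric on `M` (modelled on `ℝᵐ`), `σ ∈ C^∞(M)` with `{σ ≤ 0}` compact, `D = {σ < 0}`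
connected and `dσ ≠ 0` on `{σ = 0}`. There is `C < ∞` such that for every `f ∈ C¹(M)`,
`‖f − ⨍_D f dμ_h‖_{L²(D, μ_h)} ≤ C (∫_D h⁻¹(df, df) dμ_h)^{1/2}`.
[cite: Mazja1985, §1.1.11] -/
theorem exists_poincareWirtinger_sublevel {σ : M → ℝ} (hσ : ContMDiff (𝓡 m) 𝓘(ℝ, ℝ) ∞ σ)
    (hcpt : IsCompact {x | σ x ≤ 0}) (hconn : IsConnected {x | σ x < 0})
    (hreg : ∀ x, σ x = 0 → mvfderiv (𝓡 m) σ x ≠ 0) :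
    ∃ C : ℝ≥0∞, C ≠ ⊤ ∧ ∀ f : M → ℝ, ContMDiff (𝓡 m) 𝓘(ℝ, ℝ) 1 f →
      eLpNorm (fun p ↦ f p - ⨍ q in {p | σ p < 0}, f q ∂riemannianMeasure h) 2
        ((riemannianMeasure h).restrict {p | σ p < 0}) ≤
      C * (∫⁻ p in {p | σ p < 0},
        ENNReal.ofReal ((PseudoRiemannianMetric.ofRiemannian h).innerDual p
          (mvfderiv (𝓡 m) f p).toLinearMap (mvfderiv (𝓡 m) f p).toLinearMap)
            ∂riemannianMeasure h) ^ (1 / 2 : ℝ) := by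
  classical
  set g := PseudoRiemannianMetric.ofRiemannian h with hg
  set μ : Measure M := riemannianMeasure h with hμ
  set D : Set M := {p | σ p < 0} with hD
  set Dbar : Set M := {p | σ p ≤ 0} with hDbar
  haveI : μ.IsOpenPosMeasure := isOpenPosMeasure_riemannianMeasure h
  haveI : IsFiniteMeasureOnCompacts μ :=
    ⟨fun K' hK' ↦ riemannianVolume_lt_top_of_isCompact_holds h le_rfl hK'⟩
  have hDo : IsOpen D := isOpen_lt hσ.continuous continuous_const
  have hDDbar : D ⊆ Dbar := fun p (hp : σ p < 0) => hp.le
  have hμD : μ D ≠ ⊤ := (measure_ne_top_of_subset hDDbar hcpt.measure_lt_top.ne)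
  -- local data at every point of `D̄`
  have hloc := fun x (hx : x ∈ Dbar) => exists_local_poincare_sublevel h hσ hreg hx
  choose V hVo hxV C hC hPW using hloc
  -- a finite subcover of `D̄`
  obtain ⟨t, ht⟩ := hcpt.elim_finite_subcover (fun i : Dbar => V i.1 i.2) (fun i => hVo i.1 i.2)
    (fun p hp => mem_iUnion.2 ⟨⟨p, hp⟩, hxV p hp⟩)
  -- the cover of `D` by the pieces `V_i ∩ D`
  set U : t → Set M := fun i => V i.1.1 i.1.2 ∩ D with hU
  have hUo : ∀ i, IsOpen (U i) := fun i => (hVo _ _).inter hDo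
  have hUD : ∀ i, U i ⊆ D := fun i => inter_subset_right
  have hΩ : D = ⋃ i, U i := by
    refine Subset.antisymm (fun p hp => ?_) (iUnion_subset hUD)
    obtain ⟨i, hi, hpi⟩ := mem_iUnion₂.1 (ht (hDDbar hp))
    exact mem_iUnion.2 ⟨⟨i, hi⟩, hpi, hp⟩
  obtain ⟨K, hK, hglue⟩ := exists_eLpNorm_sub_setAverage_le_of_finite_cover (μ := μ) (F := ℝ) U hUo
    hΩ hconn.isPreconnected hμD one_le_two (fun i => C i.1.1 i.1.2) (fun i => hC _ _)
  refine ⟨K, hK, fun f hf => ?_⟩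
  set G : ℝ≥0∞ := (∫⁻ p in D, ENNReal.ofReal (g.innerDual p (mvfderiv (𝓡 m) f p).toLinearMap
    (mvfderiv (𝓡 m) f p).toLinearMap) ∂μ) ^ (1 / 2 : ℝ) with hG
  have hfi : IntegrableOn f D μ :=
    (hf.continuous.continuousOn.integrableOn_compact hcpt).mono_set hDDbar
  refine hglue f G hfi fun i => ?_
  refine (hPW i.1.1 i.1.2 f hf).trans ?_
  rw [hG]
  gcongr
  exact hUD i

end Literature.Geometry.Riemannian

end
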